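import Literature.Probability.LatticeModels.IsingThermodynamics
import HarnessLib

/-!
# New lower bounds for the critical two-point function: the reflected-gradient inequality and the
# axial lower bound of Duminil-Copin–Panis (CMP 406 (2025), arXiv:2404.05700, Theorems 1.2–1.3), at `β = β_c`

Topic `Literature/Probability/LatticeModels`; family `crit-ising`. NAMED FACTS only (defs of type
`Prop`, no axioms, nothing proved here), vendored AS PRINTED and specialised to the critical point.

Setting of the source (§1, p. 3–5 of arXiv:2404.05700): the nearest-neighbour Ising model on `ℤ^d`
(`ρ = ½(δ₋₁ + δ₁)`), `⟨·⟩_β` the weak limit of the finite-volume free-boundary measures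
`⟨·⟩_{Λ,β}` as `Λ ↑ ℤ^d` — the tree's `freeExpect d β 0` / `twoPointFree d β` — `|·|` the sup norm,
`Λ_n := [-n,n]^d ∩ ℤ^d` (the tree's `box d n`), `ℍ_n := {x : x₁ = n}` and `𝓡_n` the orthogonal
reflection in `ℍ_n` (`dcpReflect`), `x ∼ y` iff `|x - y|₂ = 1` (the tree's `(zdGraph d).Adj`),
`χ_n(β) := ∑_{x ∈ Λ_n} ⟨τ₀τ_x⟩_β` (the box susceptibility; this is the notation of
Aizenman–Duminil-Copin 2021 §5.3 / Panis 2023 which the source uses without restating it — read off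
the first display of the printed proof of Theorem 1.3,
`∑_{x,y ∈ Λ_n, x₁ ≤ n/2, y ∼ x} ⟨τ₀τ_x⟩⟨τ_yτ_{𝓡_n(y)}⟩ ≤ χ_n(β)⟨τ₀τ_{(n/4)e₁}⟩`; it is
`boxSusceptibility (twoPointFree d β) n` of `ImprovedTreeDiagramBound.lean`, written here as an
explicit `Finset` sum to keep the imports light), and `L(β)` the sharp length (Definition 1.1).

Both theorems are printed "for all `β ≤ β_c` and for all `N ≤ n ≤ L(β)`". We vendor the case
`β = β_c`, where `L(β_c) = +∞` (no finite `S ∋ 0` has `φ_{β_c}(S) < 1/2`, by sharpness; the source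
itself applies Theorem 1.2 at `β_c` "for `n` large enough" in the proof of Theorem 1.8, p. 7), i.e.
the conclusion for every integer `n ≥ N`. The positive factor `β` printed in front of the sum of
Theorem 1.2 is absorbed into the constant `c₀` (at `β = β_c > 0`; this also makes the statement
independent of the `β` vs `2β` pair-counting convention of the Hamiltonian).

Why these facts are here: they are the sharpest PRINTED lower-bound technology for the critical
two-point function in `d = 3` (where only `c/|x|² ≤ ⟨σ₀σ_x⟩_{β_c} ≤ C/|x|` is otherwise known,
`criticalTwoPoint_bounds_holds`), recorded as the nearest prior art of the open crux
`Summit.CriticalPhenomena.Ising3DConformalLimit.Theses.MirrorHoelderCompactness.TwoPointDoubling`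
(all-scale doubling `⟨σ₀σ_{2ne₁}⟩_{β_c} ≥ κ⟨σ₀σ_{ne₁}⟩_{β_c}` on `ℤ³`), which is STRONGER than
anything printed: Theorem 1.3 bounds `⟨σ₀σ_{ne₁}⟩_{β_c}` from below by the susceptibility and the
axial profile on scales `≤ 4n`, it does not compare the scales `n` and `2n`. For the plus state
(`criticalTwoPoint d = twoPointPlus d (criticalBeta d)`) use
`twoPointPlus_criticalBeta_eq_twoPointFree_holds` (`d ≥ 3`).

Deliberately NOT here: the `φ⁴` / Griffiths–Simon-class versions (Proposition 3.x of the source),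
the near-critical range `β < β_c, n ≤ L(β)` (needs the sharp length), Theorems 1.4–1.8 (the
`d ≥ 4` pointwise bounds, `η ≤ 1/2` in `d = 3`, `ν = 1/2`, divergence of the bubble diagram — the
last is treated in `Literature.Barriers.CriticalPhenomena.LaceExpansionIsingAboveFour*`), and the
gradient estimate (1.11), which is PROVED in `TwoPointGradientEstimate.lean`
(`twoPointFree_criticalBeta_gradient_estimate`).

## References

* H. Duminil-Copin, R. Panis, *New lower bounds for the (near) critical Ising and φ⁴ models'
  two-point functions*, Comm. Math. Phys. 406 (2025), arXiv:2404.05700, Theorems 1.2, 1.3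
  (numbering of the arXiv version, held) [DuminilCopinPanis2025LowerBounds].
-/

noncomputable section

open Finset
open scoped BigOperators Classical

namespace Literature.Probability.LatticeModels

variable {d : ℕ}

/-- The orthogonal reflection `𝓡_n` of `ℤ^d` in the hyperplane `ℍ_n = {x : x_i = n}`:
`x_i ↦ 2n - x_i`, other coordinates fixed (Duminil-Copin–Panis 2025, §1.1, sentence before
Theorem 1.2, with `i` the first axis). [cite: DuminilCopinPanis2025LowerBounds, §1.1 (definition of 𝓡_n before Theorem 1.2)] -/
def dcpReflect (i : Fin d) (n : ℤ) (x : Site d) : Site d :=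
  Function.update x i (2 * n - x i)

/-- **Duminil-Copin–Panis 2025, Theorem 1.2 (the main inequality), at `β = β_c`.** Printed:
"Theorem 1.2. Let `d ≥ 3`. There exist `c₀, N₀ > 0` such that for all `β ≤ β_c` and for all
`N₀ ≤ n ≤ L(β)`,
`β ∑_{x,y ∈ Λ_n, y ∼ x} (⟨τ₀τ_x⟩_β - ⟨τ₀τ_{𝓡_n(x)}⟩_β) ⟨τ_y τ_{𝓡_n(y)}⟩_β ≥ c₀`."
Here at `β = β_c` (`L(β_c) = +∞`), free infinite-volume state, `Λ_n = box d n`, `𝓡_n` the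
reflection in `{x₁ = n}` (first axis `⟨0, _⟩ : Fin d`), the factor `β_c > 0` absorbed into `c₀`;
`⟨τ_yτ_{𝓡_n(y)}⟩` is the pair correlation `freeExpect d β_c 0 (spinPair y (𝓡_n y))`. [cite: DuminilCopinPanis2025LowerBounds, Theorem 1.2] -/
def dcp_reflectedGradient_lower : Prop :=
  ∀ (hd : 3 ≤ d), ∃ c₀ : ℝ, 0 < c₀ ∧ ∃ N₀ : ℕ, 0 < N₀ ∧ ∀ n : ℕ, N₀ ≤ n →
    c₀ ≤ ∑ x ∈ box d n, ∑ y ∈ box d n,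
      if (zdGraph d).Adj x y then
        (twoPointFree d (criticalBeta d) x -
            twoPointFree d (criticalBeta d) (dcpReflect (⟨0, by omega⟩ : Fin d) (n : ℤ) x)) *
          freeExpect d (criticalBeta d) 0
            (spinPair y (dcpReflect (⟨0, by omega⟩ : Fin d) (n : ℤ) y))
      else 0

/-- **Duminil-Copin–Panis 2025, Theorem 1.3 (pointwise lower bound, all `d ≥ 3`), at `β = β_c`.**
Printed: "Theorem 1.3. Let `d ≥ 3`. There exist `c₁, N₁ > 0` such that for all `β ≤ β_c` and for
all `N₁ ≤ n ≤ L(β)`,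
`⟨τ₀τ_{ne₁}⟩_β ≥ c₁ / ( χ_{4n}(β) + n^{d-2} ∑_{1 ≤ k ≤ 2n} k ⟨τ₀τ_{ke₁}⟩_β )`."
Here at `β = β_c` (`L(β_c) = +∞`, so: every integer `n ≥ N₁`), free infinite-volume state
`twoPointFree`, `e₁ = Pi.single ⟨0, _⟩ 1`, and `χ_{4n}(β_c) = ∑_{x ∈ Λ_{4n}} ⟨τ₀τ_x⟩_{β_c}` written
out over `box d (4n)` (`= boxSusceptibility (twoPointFree d (criticalBeta d)) (4n)`). The
denominator is `≥ 1` (the `x = 0` term), so the quotient is a genuine one. [cite: DuminilCopinPanis2025LowerBounds, Theorem 1.3] -/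
def dcp_criticalTwoPoint_axis_lower : Prop :=
  ∀ (hd : 3 ≤ d), ∃ c₁ : ℝ, 0 < c₁ ∧ ∃ N₁ : ℕ, 0 < N₁ ∧ ∀ n : ℕ, N₁ ≤ n →
    c₁ / ((∑ x ∈ box d (4 * n), twoPointFree d (criticalBeta d) x) +
          (n : ℝ) ^ (d - 2) *
            ∑ k ∈ Finset.Icc 1 (2 * n),
              (k : ℝ) * twoPointFree d (criticalBeta d) (Pi.single (⟨0, by omega⟩ : Fin d) (k : ℤ)))
      ≤ twoPointFree d (criticalBeta d) (Pi.single (⟨0, by omega⟩ : Fin d) (n : ℤ))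

end Literature.Probability.LatticeModels
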